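import Literature.NumberTheory.Irrationality.RhinViola2001.LevelFourPrimeDivisors
import Literature.NumberTheory.Irrationality.RhinViola2001.TenSumsPermutations
import HarnessLib

/-!
# Rhin–Viola 2001, §4: the action of `ϕ, χ, ϑ, σ` on the ten sums (4.2) — equivariance and faithfulness

Topic `Literature/NumberTheory/Irrationality/RhinViola2001`. PROVED companion (theorems and two concrete
definitions; no named fact, no `sorry`) tying the permutations of `U = {u₁,…,u₁₀}` of `TenSumsPermutations.lean`
(`PhiGroup.thetaU`, `phiU`, `chiU`, `sigmaU`, the subgroup `PhiGroup.Phi`) to the tree's parameter maps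
`theta`, `sigma`, `phi`, `chi`, `Gen.act`, `act` of `GroupStructure.lean`. Source read on the page: G. Rhin,
C. Viola, *The group structure for ζ(3)*, Acta Arith. **97** (2001) 269–293 [RhinViola2001], §4 pp. 281–282
and 284 (held text `paper:doi-10-4064-aa97-3-6`, p0013–p0014, p0016).

HONEST FRAMING (cells pub-zeta5 / zeta5-irr): systematic search; no irrationality claim unless certified.
Bookkeeping of a 2001 `ζ(3)` paper's permutation group; nothing about `ζ(5)`, measures or denominators.

## What is printed and how it is typed

p. 281–282: "It is easy to see that `ϕ, χ, ϑ` and `σ` can be viewed as permutations of ten integers only, i.e.,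
of the sums (4.2) `h+l, j+m, k+q, l+r, m+s, q+h, r+j, s+k, j+q, k+r`. To prove this, it suffices to show
that `ϕ, χ, ϑ` and `σ` permute the sums (4.2), and that if a permutation `ϱ` lying in the group
`Φ = ⟨ϕ, χ, ϑ, σ⟩` … acts identically on the sums (4.2), it acts identically also on `h, j, k, l, m, q, r, s`.
Note that, by (2.2) and (2.3), the last two sums in (4.2) can be written as `l+s` and `h+m` respectively.
Then … the actions of `ϕ, χ, ϑ` and `σ` on the ten sums (4.2) are the following:
`ϕ = (k+q  k+r)(r+j  j+q)`, `χ = (j+m  k+q)(q+h  r+j)`, `ϑ = (h+l  j+m  k+q  l+r  m+s  q+h  r+j  s+k)(j+q  k+r)`,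
`σ = (h+l  s+k)(j+m  r+j)(k+q  q+h)(l+r  m+s)`. Moreover, if `ϱ ∈ Φ` acts identically on the sums (4.2) we get,
by linearity, `2ϱ(h) = ϱ(2h) = ϱ((h+l) − (l+r) + (r+k) − (k+q) + (q+h)) = … = 2h`, and similarly
`2ϱ(j) = ϱ(2j) = ϱ(j+m) − ϱ(m+s) + ϱ(s+l) − ϱ(l+r) + ϱ(r+j) = 2j`, and so on." p. 284 (4.4): a product `ϱ` of
the integral transformations acts on `I(h,…,s)/(h!⋯s!)` "where `ϱ` is the corresponding product of permutations
`ϕ, χ, ϑ` and `σ` in reverse order".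

TYPED: `tenSums P : Fin 10 → ℤ` (the sums (4.2) in the printed order, `uᵢ ↦ i − 1`); `genPerm : Gen → Perm (Fin 10)`
(the permutation of `U` attached to a generator: `PhiGroup.phiU`, …); `wordPerm : List Gen → Perm (Fin 10)`, the
product "in reverse order". PROVED: equivariance `tenSums (g.act P) i = tenSums P (genPerm g i)` for parameters
satisfying (2.2)–(2.3) (`tenSums_genAct`; the last two sums need (2.2)–(2.3) exactly as printed), hence for words
(`tenSums_act`, using the tree's `LevelFour.balanced_act`); the printed linear identities for `2h` and `2j`
(`two_mul_h_eq`, `two_mul_j_eq`) and FAITHFULNESS: the ten sums determine the parameters (`eq_of_tenSums_eq`), so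
words with the same permutation of `U` act identically on the parameters (`act_eq_of_wordPerm_eq`,
`act_eq_self_of_wordPerm_eq_one`); every word's permutation lies in `Φ` and every element of `Φ` is the
permutation of a word (`wordPerm_mem_Phi`, `exists_word_of_mem_Phi`), so that, with
`mem_Phi_iff` of `PermutationGroupOrder.lean`, the 1920 even block-preserving permutations of the ten sums are
exactly the actions of products of `ϕ, χ, ϑ, σ` (`exists_word_realising`, stated here for `π ∈ Φ`).
NOT here: (4.4)–(4.6) themselves (tree: `normI_act` in `GroupStructure.lean`, `TransformationPrimeDivisors.total_act`).
-/

namespace Literature.NumberTheory.Irrationality.RhinViola2001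

namespace PhiGroup

open Equiv Equiv.Perm
open LevelFour (balanced_act)

/-! ### The ten sums (4.2) and the permutations attached to the generators -/

/-- The ten sums (4.2) `u₁,…,u₁₀ = h+l, j+m, k+q, l+r, m+s, q+h, r+j, s+k, j+q, k+r` (entry `i − 1` is `uᵢ`).
[cite: RhinViola2001, §4 (4.2), p. 281] -/
def tenSums (P : Params) : Fin 10 → ℤ :=
  ![P.h + P.l, P.j + P.m, P.k + P.q, P.l + P.r, P.m + P.s, P.q + P.h, P.r + P.j, P.s + P.k, P.j + P.q, P.k + P.r]

/-- The permutation of `U` attached to a generator (p. 282: `ϕ = (u₃ u₁₀)(u₇ u₉)`, `χ = (u₂ u₃)(u₆ u₇)`,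
`ϑ = (u₁ … u₈)(u₉ u₁₀)`, `σ = (u₁ u₈)(u₂ u₇)(u₃ u₆)(u₄ u₅)`). [cite: RhinViola2001, §4 p. 282] -/
def genPerm : Gen → Perm (Fin 10)
  | .Phi => phiU
  | .Chi => chiU
  | .Theta => thetaU
  | .Sigma => sigmaU

/-- The values of the four permutations (plumbing). [cite: RhinViola2001, §4 p. 282] -/
theorem genPerm_apply (g : Gen) : ⇑(genPerm g) =
    match g with
    | .Phi => ![0, 1, 9, 3, 4, 5, 8, 7, 6, 2]
    | .Chi => ![0, 2, 1, 3, 4, 6, 5, 7, 8, 9]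
    | .Theta => ![1, 2, 3, 4, 5, 6, 7, 0, 9, 8]
    | .Sigma => ![7, 6, 5, 4, 3, 2, 1, 0, 8, 9] := by
  cases g <;> funext i <;> fin_cases i <;> rfl

/-- The permutations attached to the generators lie in `Φ`. [cite: RhinViola2001, §4 p. 282] -/
theorem genPerm_mem_Phi (g : Gen) : genPerm g ∈ Phi := by
  cases g <;> exact Subgroup.subset_closure (by simp [genPerm])

/-! ### "`ϕ, χ, ϑ` and `σ` permute the sums (4.2)" -/

/-- **Equivariance for one generator**: `uᵢ(g·P) = u_{π_g(i)}(P)` for parameters satisfying (2.2)–(2.3) ("by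
(2.2) and (2.3), the last two sums in (4.2) can be written as `l+s` and `h+m`" — the hypothesis is used exactly
for `u₉, u₁₀` and for the sums through `q' = q+h−r`, `r' = r+j−s`, `j' = j+m−k`). [cite: RhinViola2001, §4 p. 282] -/
theorem tenSums_genAct (g : Gen) {P : Params} (hP : P.Balanced) (i : Fin 10) :
    tenSums (g.act P) i = tenSums P (genPerm g i) := by
  obtain ⟨h1, h2⟩ := hP
  rw [genPerm_apply]
  cases g <;> fin_cases i <;> simp [tenSums, Gen.act, phi, chi, theta, sigma, Params.aux] <;> omega

/-- The permutation of `U` attached to a word `ϱ = [g₁, …, gₙ]` of transformations (applied right to left, as the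
tree's `act`): "the corresponding product of permutations `ϕ, χ, ϑ` and `σ` in reverse order", `π_{gₙ} ⋯ π_{g₁}`.
[cite: RhinViola2001, §4 p. 284 ((4.4), "in reverse order")] -/
def wordPerm : List Gen → Perm (Fin 10)
  | [] => 1
  | g :: w => wordPerm w * genPerm g

/-- `wordPerm` of a concatenation (plumbing for "in reverse order"). [cite: RhinViola2001, §4 p. 284] -/
theorem wordPerm_append (w w' : List Gen) : wordPerm (w ++ w') = wordPerm w' * wordPerm w := by
  induction w with
  | nil => simp [wordPerm]
  | cons g w ih => simp [wordPerm, ih, mul_assoc]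

/-- Every word's permutation lies in `Φ`. [cite: RhinViola2001, §4 p. 282 (definition of Φ)] -/
theorem wordPerm_mem_Phi (w : List Gen) : wordPerm w ∈ Phi := by
  induction w with
  | nil => exact Subgroup.one_mem _
  | cons g w ih => exact Subgroup.mul_mem _ ih (genPerm_mem_Phi g)

/-- **Equivariance for words**: `uᵢ(ϱ·P) = u_{π_ϱ(i)}(P)` for parameters satisfying (2.2)–(2.3), with `π_ϱ` the
product in reverse order. [cite: RhinViola2001, §4 pp. 282, 284] -/
theorem tenSums_act (w : List Gen) {P : Params} (hP : P.Balanced) (i : Fin 10) :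
    tenSums (act w P) i = tenSums P (wordPerm w i) := by
  induction w generalizing i with
  | nil => rfl
  | cons g w ih =>
    show tenSums (g.act (act w P)) i = tenSums P ((wordPerm w * genPerm g) i)
    rw [tenSums_genAct g (balanced_act w hP), ih, Perm.mul_apply]

/-- Every permutation in `Φ` is the permutation of some word in the generators (`Φ = ⟨ϕ, χ, ϑ, σ⟩`; inverses
are positive powers in a finite group). [cite: RhinViola2001, §4 p. 281 (definition of Φ)] -/
theorem exists_word_of_mem_Phi {π : Perm (Fin 10)} (hπ : π ∈ Phi) : ∃ w : List Gen, wordPerm w = π := by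
  have hpow : ∀ (w : List Gen) (n : ℕ), wordPerm (List.replicate n w).flatten = wordPerm w ^ n := by
    intro w n
    induction n with
    | zero => simp [wordPerm]
    | succ n ih => rw [List.replicate_succ, List.flatten_cons, wordPerm_append, ih, pow_succ]
  induction hπ using Subgroup.closure_induction with
  | mem x hx =>
    simp only [Set.mem_insert_iff, Set.mem_singleton_iff] at hx
    rcases hx with rfl | rfl | rfl | rfl
    · exact ⟨[.Phi], by simp [wordPerm, genPerm]⟩
    · exact ⟨[.Chi], by simp [wordPerm, genPerm]⟩
    · exact ⟨[.Theta], by simp [wordPerm, genPerm]⟩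
    · exact ⟨[.Sigma], by simp [wordPerm, genPerm]⟩
  | one => exact ⟨[], rfl⟩
  | mul x y _ _ ihx ihy =>
    obtain ⟨w, rfl⟩ := ihx
    obtain ⟨w', rfl⟩ := ihy
    exact ⟨w' ++ w, wordPerm_append w' w⟩
  | inv x _ ih =>
    obtain ⟨w, rfl⟩ := ih
    refine ⟨(List.replicate (orderOf (wordPerm w) - 1) w).flatten, ?_⟩
    rw [hpow]
    have ho : 0 < orderOf (wordPerm w) := orderOf_pos _
    have h1 : wordPerm w ^ (orderOf (wordPerm w) - 1) * wordPerm w = 1 := by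
      rw [← pow_succ, Nat.sub_add_cancel ho, pow_orderOf_eq_one]
    exact eq_inv_of_mul_eq_one_left h1

/-! ### Faithfulness: "if `ϱ ∈ Φ` acts identically on the sums (4.2), it acts identically also on `h, …, s`" -/

/-- "`2h = (h+l) − (l+r) + (r+k) − (k+q) + (q+h)`" (no hypothesis needed). [cite: RhinViola2001, §4 p. 282] -/
theorem two_mul_h_eq (P : Params) :
    2 * P.h = tenSums P 0 - tenSums P 3 + tenSums P 9 - tenSums P 2 + tenSums P 5 := by
  simp [tenSums]; ring

/-- "`2j = (j+m) − (m+s) + (s+l) − (l+r) + (r+j)`", with `s+l = j+q = u₉` by (2.3). [cite: RhinViola2001, §4 p. 282] -/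
theorem two_mul_j_eq {P : Params} (hP : P.Balanced) :
    2 * P.j = tenSums P 1 - tenSums P 4 + tenSums P 8 - tenSums P 3 + tenSums P 6 := by
  obtain ⟨_, h2⟩ := hP
  simp [tenSums]; omega

/-- **Faithfulness**: the ten sums (4.2) determine the eight parameters ("and so on": `2k = (k+r) − (r+j) + (j+m)
− (m+s) + (s+k)`, then `l = u₁ − h`, `q = u₆ − h`, `r = u₁₀ − k`, `s = u₈ − k`, `m = u₂ − j`).
[cite: RhinViola2001, §4 p. 282] -/
theorem eq_of_tenSums_eq {P Q : Params} (h : tenSums P = tenSums Q) : P = Q := by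
  have e := fun i => congrFun h i
  have e0 := e 0; have e1 := e 1; have e2 := e 2; have e3 := e 3; have e4 := e 4
  have e5 := e 5; have e6 := e 6; have e7 := e 7; have e8 := e 8; have e9 := e 9
  simp [tenSums] at e0 e1 e2 e3 e4 e5 e6 e7 e8 e9
  ext <;> omega

/-- "if a permutation `ϱ` lying in the group `Φ` acts identically on the sums (4.2), it acts identically also on
`h, j, k, l, m, q, r, s`": two words with the same permutation of `U` act identically on every parameter set
satisfying (2.2)–(2.3). [cite: RhinViola2001, §4 p. 282] -/
theorem act_eq_of_wordPerm_eq {w w' : List Gen} (h : wordPerm w = wordPerm w') {P : Params} (hP : P.Balanced) :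
    act w P = act w' P :=
  eq_of_tenSums_eq (funext fun i => by rw [tenSums_act w hP, tenSums_act w' hP, h])

/-- In particular a word whose permutation of `U` is the identity acts identically on the parameters.
[cite: RhinViola2001, §4 p. 282] -/
theorem act_eq_self_of_wordPerm_eq_one {w : List Gen} (h : wordPerm w = 1) {P : Params} (hP : P.Balanced) :
    act w P = P :=
  act_eq_of_wordPerm_eq (w' := []) h hP

/-- Consequently the permutation group `Φ` of order 1920 acts on the balanced parameters through words: every
`π ∈ Φ` is realised by a product `ϱ` of `ϕ, χ, ϑ, σ` with `uᵢ(ϱ·P) = u_{π(i)}(P)` for all `P` with (2.2)–(2.3),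
and two realisations act identically. [cite: RhinViola2001, §4 pp. 282–284] -/
theorem exists_word_realising {π : Perm (Fin 10)} (hπ : π ∈ Phi) :
    ∃ w : List Gen, ∀ P : Params, P.Balanced → ∀ i, tenSums (act w P) i = tenSums P (π i) := by
  obtain ⟨w, rfl⟩ := exists_word_of_mem_Phi hπ
  exact ⟨w, fun P hP i => tenSums_act w hP i⟩

end PhiGroup

end Literature.NumberTheory.Irrationality.RhinViola2001
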